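import Literature.NumberTheory.Rogawski1990.OneDimAutRepH
import HarnessLib

/-!
# «Aχ» — the χ-currency of Rogawski's archimedean triple `φ(a,b,c) = rogTriple p q t`: the Casimir scalar
# `κ = a² + b² + c² − 2`, the central exponent `e₁ = a + b + c`, and `IsCohTrivial ⟺ κ = 0 ∧ e₁ = 0`

Cell `hodgecm-mathlib`, F0∕P3c line LH1 (closer stub `stub_S2sharp` of `Cruxes/H413/Lines/F0_U3LettersRung1.lean`, crux H413 =
`stmt-HodgeConjecture-24833`); deal «Aχ» of LH1-plan (g4) 2026-09-02T04:13:36Z to LH1-p02 (g2).  DEF lane: two `ℤ`-valued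
definitions with bodies (`rogCasimirScalar`, `rogCentralSum`) + theorems; no instance, no notation, no named fact, no `sorry`.
Pure integer arithmetic over ★ `Literature.NumberTheory.Rogawski1990.OneDimAutRepH` §5 (`ArchSignRecipe.rogTriple` :264,
`IsCohTrivial` :330, `isCohTrivial_iff` :334, `OneDimAutRepH.IsCohTrivialAt` :381).

PRINT.  [Rogawski1990 §12.3 p. 178] attaches to the component `ξ_ι = (p, q; t)` of a one-dimensional automorphic `ξ` of `H`
the triple `φ = φ(a,b,c)`, `a ≥ b ≥ c`, `(a,b,c) = rogTriple p q t ∈ {(q, q+s+1, q+s), (q+s+1, q+s, q)}`, `s = p + t`, and the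
archimedean packet `Π(ξ_ι) = {J^±_φ, D^∓_φ ∕ π²_φ} ⊂ JH(i_G(χ^±_φ))`: every member has the infinitesimal character `χ_φ` with
Harish-Chandra parameter `(a, b, c)` (= highest weight `(a−1, b, c+1)` of `F_φ` plus `ρ = (1, 0, −1)`) and the central character
`u·1 ↦ u^{a+b+c}` of `i_G(χ^±_φ)`.  Two WEYL-SYMMETRIC integers of `(a, b, c)` therefore see every member of the packet:
* **`κ(p,q,t) = a² + b² + c² − 2 = ⟨(a,b,c),(a,b,c)⟩ − ⟨ρ,ρ⟩`** — the eigenvalue of the trace-form Casimir element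
  `C = Σ_{i,j} E_{ij} E_{ji}` of `𝔤𝔩₃ = 𝔲(2,1)_ℂ` on a module with infinitesimal character `(a,b,c)`
  (`χ_λ(Ω) = ⟨λ,λ⟩ − ⟨δ,δ⟩` for Harish-Chandra parameter `λ` [KnappVogan1995, Prop. 4.120 p. 280; held chunk p0280–p0281];
  `π(C) = (|Λ|² − |ρ|²)·1` [BorelWallach2000, II Prop. 6.12 (2); held chunk p0075]); and
* **`e₁(p,q,t) = a + b + c`** — the central exponent (`i·1 ∈ 𝔲(2,1)` acts by `i·e₁`; under the conjugate identification
  `L_w = ℂ`, `(p,q,t) ↦ (−p,−q,−t−1)`, `e₁ ↦ −e₁` while `κ` is invariant, §4).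
The point of this file (§3): **`IsCohTrivial p q t` (`φ = φ(1,0,−1)`) `⟺ κ = 0 ∧ e₁ = 0`**, while `κ = 0` ALONE also holds at
the two spurious points `(q, p+t) ∈ {(1,−1), (−1,0)}` (`rogCasimirScalar_eq_zero_iff`) — so in the χ-road to PIN-ι
(Wigner: `H¹(𝔤,K;M) ≠ 0 ⇒ C = 0 ∧` centre `= 0`, ★ `GKCohomologyCasimirCriterion` ∕ `GKCohomologyCasimir`) the CENTRE clause is
load-bearing.  Closed forms (§2, case-free): `e₁ = 3q + 2(p+t) + 1`, `κ = q² + (q+p+t+1)² + (q+p+t)² − 2`.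

HONEST LABEL: HC_CM is proved only modulo the 7 printed citations (2 remaining: hLiu418 = stmt-HodgeConjecture-24832, h413 =
stmt-HodgeConjecture-24833) until rung 0 closes; this file is count-neutral arithmetic (no statement of #80 is restated).

References: [Rogawski1990] J. Rogawski, *Automorphic representations of unitary groups in three variables*, Ann. of Math. Stud.
123 (1990), §12.3 pp. 174–178 (`χ_φ^± `, `J^±_φ`, `F_φ`, Prop. 12.3.3), Prop. 15.2.1 p. 249; [KnappVogan1995] A. W. Knapp, D. A. Vogan,
*Cohomological induction and unitary representations*, Princeton Math. Ser. 45 (1995), Prop. 4.120 p. 280 (Casimir eigenvalue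
`χ_λ(Ω) = ⟨λ,λ⟩ − ⟨δ,δ⟩`); [BorelWallach2000] I §5.3, II Cor. 3.3 (Wigner), II Prop. 6.12 (2) (`π(C) = (|Λ|² − |ρ|²)·1`).
-/

set_option autoImplicit false
set_option linter.dupNamespace false

namespace Summit.HodgeConjecture.HodgeConjecture.Cruxes.H413.F0P3cRogTripleChiArithmetic

open NumberField
open Literature.NumberTheory.Rogawski1990 Literature.NumberTheory.Rogawski1990.ArchSignRecipe

/-! ## §1 The two Weyl-symmetric integers of `φ(a,b,c) = rogTriple p q t` -/

/-- **`κ(p,q,t) = a² + b² + c² − 2`**, `(a,b,c) = rogTriple p q t`: the trace-form Casimir scalar `|λ+ρ|² − |ρ|²` of the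
infinitesimal character `(a,b,c)` of `Π(ξ_ι)` (`ρ = (1,0,−1)`, `|ρ|² = 2`). [cite: Rogawski1990, §12.3 p. 178] [cite: KnappVogan1995, Prop. 4.120 (p. 280)] [cite: BorelWallach2000, II Prop. 6.12 (2)] -/
def rogCasimirScalar (p q t : ℤ) : ℤ :=
  (rogTriple p q t).1 ^ 2 + (rogTriple p q t).2.1 ^ 2 + (rogTriple p q t).2.2 ^ 2 - 2

/-- **`e₁(p,q,t) = a + b + c`**, `(a,b,c) = rogTriple p q t`: the central exponent of `Π(ξ_ι) ⊂ JH(i_G(χ^±_φ))` (the centre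
`u·1` of `U(2,1)` acts by `u^{a+b+c}`). [cite: Rogawski1990, §12.3 p. 178] -/
def rogCentralSum (p q t : ℤ) : ℤ :=
  (rogTriple p q t).1 + (rogTriple p q t).2.1 + (rogTriple p q t).2.2

/-! ## §2 Closed forms (independent of the `±` case of the recipe) -/

/-- **`e₁ = 3q + 2(p + t) + 1`** in both cases of the recipe (`{a,b,c} = {q, q+p+t+1, q+p+t}`). [cite: Rogawski1990, §12.3 p. 178] -/
theorem rogCentralSum_eq (p q t : ℤ) : rogCentralSum p q t = 3 * q + 2 * (p + t) + 1 := by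
  unfold rogCentralSum rogTriple
  by_cases h : p + t ≤ -1
  · rw [if_pos h]; ring
  · rw [if_neg h]; ring

/-- **`κ = q² + (q+p+t+1)² + (q+p+t)² − 2`** in both cases of the recipe. [cite: Rogawski1990, §12.3 p. 178] [cite: KnappVogan1995, Prop. 4.120 (p. 280)] [cite: BorelWallach2000, II Prop. 6.12 (2)] -/
theorem rogCasimirScalar_eq (p q t : ℤ) :
    rogCasimirScalar p q t = q ^ 2 + (q + p + t + 1) ^ 2 + (q + p + t) ^ 2 - 2 := by
  unfold rogCasimirScalar rogTriple
  by_cases h : p + t ≤ -1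
  · rw [if_pos h]
  · rw [if_neg h]; ring

/-- `κ` and `e₁` are SYMMETRIC in `(a, b, c)` — they depend only on the multiset `{q, q+p+t+1, q+p+t}`, not on the `±` case:
the values at the `+`-ordered triple `(q, q+p+t+1, q+p+t)` and at the `−`-ordered triple `(q+p+t+1, q+p+t, q)` agree.
[cite: Rogawski1990, §12.3 p. 178] -/
theorem chi_weyl_symmetric (p q t : ℤ) :
    rogCasimirScalar p q t = q ^ 2 + (q + p + t + 1) ^ 2 + (q + p + t) ^ 2 - 2 ∧
      rogCasimirScalar p q t = (q + p + t + 1) ^ 2 + (q + p + t) ^ 2 + q ^ 2 - 2 ∧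
      rogCentralSum p q t = q + (q + p + t + 1) + (q + p + t) ∧
      rogCentralSum p q t = (q + p + t + 1) + (q + p + t) + q := by
  rw [rogCasimirScalar_eq, rogCentralSum_eq]
  refine ⟨rfl, by ring, by ring, by ring⟩

/-! ## §3 `IsCohTrivial ⟺ κ = 0 ∧ e₁ = 0`; the spurious roots of `κ` -/

/-- **The roots of `κ`**: `κ(p,q,t) = 0 ⟺ (q, p+t) ∈ {(1,−2), (−1,1), (1,−1), (−1,0)}` — the first two are the cohomological
points (★ `isCohTrivial_iff`), the last two are SPURIOUS (there `φ = φ(1,1,0)` resp. `φ(0,−1,−1)`, singular, `e₁ = ±2`), which is why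
the χ-road needs the centre.  (`q² + u² + (u+1)² = 2`, `u = q+p+t`, forces `q = ±1`, `u ∈ {0,−1}`.) [cite: Rogawski1990, §12.3 p. 178] -/
theorem rogCasimirScalar_eq_zero_iff (p q t : ℤ) :
    rogCasimirScalar p q t = 0 ↔
      (q = 1 ∧ p + t = -2) ∨ (q = -1 ∧ p + t = 1) ∨ (q = 1 ∧ p + t = -1) ∨ (q = -1 ∧ p + t = 0) := by
  rw [rogCasimirScalar_eq]
  obtain ⟨u, hu⟩ : ∃ u : ℤ, q + p + t = u := ⟨_, rfl⟩
  rw [show q + p + t + 1 = u + 1 by rw [hu], hu]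
  constructor
  · intro h
    have hq2 : q ^ 2 ≤ 2 := by nlinarith [sq_nonneg (u + 1), sq_nonneg u]
    have hu2 : u ^ 2 ≤ 2 := by nlinarith [sq_nonneg (u + 1), sq_nonneg q]
    have hq1 : q ≤ 1 := by nlinarith
    have hq1' : -1 ≤ q := by nlinarith
    have hu1 : u ≤ 1 := by nlinarith
    have hu1' : -1 ≤ u := by nlinarith
    interval_cases q <;> interval_cases u <;> omega
  · rintro (⟨rfl, h⟩ | ⟨rfl, h⟩ | ⟨rfl, h⟩ | ⟨rfl, h⟩)
    · have hu' : u = -1 := by omega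
      subst hu'; norm_num
    · have hu' : u = 0 := by omega
      subst hu'; norm_num
    · have hu' : u = 0 := by omega
      subst hu'; norm_num
    · have hu' : u = -1 := by omega
      subst hu'; norm_num

/-- **`φ(a,b,c) = φ(1,0,−1)` iff `κ = 0` and `e₁ = 0`**: the cohomological-weight condition ★ `IsCohTrivial p q t` in χ-currency
(Casimir scalar and central exponent both those of the trivial representation) — the Wigner form of [Rogawski1990, Prop. 15.2.1 (b)]
at the archimedean packet `Π(ξ_ι)`. [cite: Rogawski1990, §12.3 p. 178; Prop. 15.2.1 (b) p. 249] [cite: BorelWallach2000, I §5.3] -/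
theorem isCohTrivial_iff_chi (p q t : ℤ) :
    IsCohTrivial p q t ↔ rogCasimirScalar p q t = 0 ∧ rogCentralSum p q t = 0 := by
  rw [isCohTrivial_iff, rogCasimirScalar_eq_zero_iff, rogCentralSum_eq]
  omega

/-- **«Aχ» (A2), the name the LH1 pay-down skeleton imports: `κ = 0 ∧ e₁ = 0 ⟹ IsCohTrivial`** (the triple is then the sorted
permutation `(1,0,−1)`). [cite: Rogawski1990, §12.3 p. 178; Prop. 15.2.1 (b) p. 249] -/
theorem aχ_isCohTrivial_of_chi {p q t : ℤ} (hκ : rogCasimirScalar p q t = 0) (he : rogCentralSum p q t = 0) :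
    IsCohTrivial p q t :=
  (isCohTrivial_iff_chi p q t).2 ⟨hκ, he⟩

/-- On the cohomological locus `κ = 0`. [cite: Rogawski1990, §12.3 p. 178; Prop. 15.2.1 (b) p. 249] -/
theorem rogCasimirScalar_eq_zero_of_isCohTrivial {p q t : ℤ} (h : IsCohTrivial p q t) : rogCasimirScalar p q t = 0 :=
  ((isCohTrivial_iff_chi p q t).1 h).1

/-- On the cohomological locus `e₁ = 0` (`φ(1,0,−1)`: trivial central character). [cite: Rogawski1990, §12.3 p. 178; Prop. 15.2.1 (b) p. 249] -/
theorem rogCentralSum_eq_zero_of_isCohTrivial {p q t : ℤ} (h : IsCohTrivial p q t) : rogCentralSum p q t = 0 :=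
  ((isCohTrivial_iff_chi p q t).1 h).2

/-- **Off the locus one of the two scalars is non-zero** (the disjunction the residual clauses consume: centre ≠ 0 OR Casimir ≠ 0
⇒ no `(𝔤,K)`-cohomology with trivial coefficients). [cite: Rogawski1990, §12.3 p. 178; Prop. 15.2.1 p. 249] [cite: BorelWallach2000, I §5.3] -/
theorem chi_ne_zero_of_not_isCohTrivial {p q t : ℤ} (h : ¬ IsCohTrivial p q t) :
    rogCentralSum p q t ≠ 0 ∨ rogCasimirScalar p q t ≠ 0 := by
  rcases eq_or_ne (rogCentralSum p q t) 0 with he | he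
  · exact Or.inr fun hκ => h ((isCohTrivial_iff_chi p q t).2 ⟨hκ, he⟩)
  · exact Or.inl he

/-- χ-currency with complex scalars: `(κ : ℂ) = 0` and `(e₁ : ℂ) = 0` give `IsCohTrivial` (the form in which a `(𝔤, K)`-module
delivers the two scalars). [cite: Rogawski1990, §12.3 p. 178; Prop. 15.2.1 (b) p. 249] -/
theorem isCohTrivial_of_chi_cast {p q t : ℤ} (hκ : (rogCasimirScalar p q t : ℂ) = 0) (he : (rogCentralSum p q t : ℂ) = 0) :
    IsCohTrivial p q t :=
  (isCohTrivial_iff_chi p q t).2 ⟨by exact_mod_cast hκ, by exact_mod_cast he⟩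

/-- **The `±`-form** (orientation-free: the frame may read the centre through `ι` or `ῑ`, `e₁ ↦ −e₁`): if the Casimir scalar is
`(κ : ℂ) = 0` and the centre `i·1` acts by `(s·i)` with `s = e₁` or `s = −e₁` and `s·i = 0`, then `IsCohTrivial p q t`.
[cite: Rogawski1990, §12.3 p. 178; Prop. 15.2.1 (b) p. 249] [cite: BorelWallach2000, I §5.3] -/
theorem isCohTrivial_of_chi_pm {p q t : ℤ} (hκ : (rogCasimirScalar p q t : ℂ) = 0) {s : ℤ}
    (hs : s = rogCentralSum p q t ∨ s = -rogCentralSum p q t) (hs0 : (s : ℂ) * Complex.I = 0) : IsCohTrivial p q t := by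
  have hs' : (s : ℂ) = 0 := (mul_eq_zero.1 hs0).resolve_right Complex.I_ne_zero
  have hsz : s = 0 := by exact_mod_cast hs'
  refine (isCohTrivial_iff_chi p q t).2 ⟨by exact_mod_cast hκ, ?_⟩
  rcases hs with h | h <;> omega

/-- **(A6) The `det^m` family** (calibration row of the desk's (c4)): at `q = m + 1`, `p + t = −2` (the `+` case) Rogawski's triple is
`(m+1, m, m−1)` — the Harish-Chandra parameter of `det^m` on `U(2,1)` (`m = 0`: the trivial representation, `φ(1,0,−1)`).
[cite: Rogawski1990, §12.3 p. 178] -/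
theorem rogTriple_q_succ (m p t : ℤ) (h : p + t = -2) : rogTriple p (m + 1) t = (m + 1, m, m - 1) := by
  unfold rogTriple
  rw [if_pos (by omega)]
  ext <;> simp only <;> omega

/-- **(A6) χ of the `det^m` family**: `κ = 3m²` and `e₁ = 3m` at `q = m + 1`, `p + t = −2` — the values the tree's Casimir ★
`upqDetCharCasimirScalar (Fin 2) (Fin 1) m` and the centre `i·1 ↦ 3m·i` take on `det^m` (★ `UpqDeterminantCharacter`), which calibrates
the normalisation `κ = |λ+ρ|² − |ρ|²` of the χ-road. [cite: Rogawski1990, §12.3 p. 178] [cite: KnappVogan1995, Prop. 4.120 (p. 280)] [cite: BorelWallach2000, II Prop. 6.12 (2)] -/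
theorem chi_q_succ (m p t : ℤ) (h : p + t = -2) :
    rogCasimirScalar p (m + 1) t = 3 * m ^ 2 ∧ rogCentralSum p (m + 1) t = 3 * m := by
  rw [rogCasimirScalar_eq, rogCentralSum_eq]
  have ht : t = -2 - p := by omega
  subst ht
  constructor <;> ring

/-! ## §4 Orientation: `(p,q,t) ↦ (−p,−q,−t−1)` reverses and negates the triple; `κ` is invariant, `e₁ ↦ −e₁` -/

/-- **Under the conjugate identification `L_w = ℂ`** (`(p,q,t) ↦ (−p,−q,−t−1)`, ★ `expAt_conjugate`) Rogawski's triple becomes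
`(−c,−b,−a)`: the two cases of the recipe are exchanged. [cite: Rogawski1990, §12.3 pp. 174–178] -/
theorem rogTriple_conj (p q t : ℤ) :
    rogTriple (-p) (-q) (-t - 1) = (-(rogTriple p q t).2.2, -(rogTriple p q t).2.1, -(rogTriple p q t).1) := by
  unfold rogTriple
  by_cases h : p + t ≤ -1
  · have h' : ¬ (-p + (-t - 1) ≤ -1) := by omega
    rw [if_neg h', if_pos h]
    ext <;> simp only <;> omega
  · have h' : -p + (-t - 1) ≤ -1 := by omega
    rw [if_pos h', if_neg h]
    ext <;> simp only <;> omega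

/-- `κ` is invariant under `(p,q,t) ↦ (−p,−q,−t−1)` (a symmetric function of the squares). [cite: Rogawski1990, §12.3 p. 178] -/
theorem rogCasimirScalar_conj (p q t : ℤ) : rogCasimirScalar (-p) (-q) (-t - 1) = rogCasimirScalar p q t := by
  rw [rogCasimirScalar_eq, rogCasimirScalar_eq]
  ring

/-- `e₁ ↦ −e₁` under `(p,q,t) ↦ (−p,−q,−t−1)` (the conjugate embedding reads the centre `u·1` as `ū·1 = u⁻¹·1`).
[cite: Rogawski1990, §12.3 p. 178] -/
theorem rogCentralSum_conj (p q t : ℤ) : rogCentralSum (-p) (-q) (-t - 1) = -rogCentralSum p q t := by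
  rw [rogCentralSum_eq, rogCentralSum_eq]
  ring

/-- The χ-pair is orientation-free up to the sign of `e₁`: `(κ, |e₁|)` is invariant. [cite: Rogawski1990, §12.3 p. 178] -/
theorem rogCentralSum_conj_natAbs (p q t : ℤ) : (rogCentralSum (-p) (-q) (-t - 1)).natAbs = (rogCentralSum p q t).natAbs := by
  rw [rogCentralSum_conj, Int.natAbs_neg]

/-! ## §5 Read-backs for a one-dimensional automorphic `ξ` at an embedding `ι` (`p = ξ.pη ι`, `q = ξ.qψ ι`) -/

section Xi

variable {L : Type} [Field L] [NumberField L] [IsCMField L]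

/-- **`ξ.IsCohTrivialAt t ι ⟺ κ = 0 ∧ e₁ = 0`** at `(p,q,t) = (ξ.pη ι, ξ.qψ ι, t)`. [cite: Rogawski1990, §12.3 p. 178; Prop. 15.2.1 (b) p. 249] -/
theorem isCohTrivialAt_iff_chi (ξ : OneDimAutRepH L) (t : ℤ) (ι : L →+* ℂ) :
    ξ.IsCohTrivialAt t ι ↔ rogCasimirScalar (ξ.pη ι) (ξ.qψ ι) t = 0 ∧ rogCentralSum (ξ.pη ι) (ξ.qψ ι) t = 0 :=
  isCohTrivial_iff_chi _ _ _

/-- The `±`-form for `ξ`: `(κ : ℂ) = 0`, centre acting by `s·i` with `s = ±e₁`, `s·i = 0` ⇒ `ξ.IsCohTrivialAt t ι`.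
[cite: Rogawski1990, §12.3 p. 178; Prop. 15.2.1 (b) p. 249] [cite: BorelWallach2000, I §5.3] -/
theorem isCohTrivialAt_of_chi_pm (ξ : OneDimAutRepH L) (t : ℤ) (ι : L →+* ℂ)
    (hκ : (rogCasimirScalar (ξ.pη ι) (ξ.qψ ι) t : ℂ) = 0) {s : ℤ}
    (hs : s = rogCentralSum (ξ.pη ι) (ξ.qψ ι) t ∨ s = -rogCentralSum (ξ.pη ι) (ξ.qψ ι) t) (hs0 : (s : ℂ) * Complex.I = 0) :
    ξ.IsCohTrivialAt t ι :=
  isCohTrivial_of_chi_pm hκ hs hs0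

/-- `κ` at the conjugate embedding (with `t ↦ −t−1`) equals `κ` at `ι` (★ `pη_conjugate`, `qψ_conjugate`). [cite: Rogawski1990, §12.3 pp. 174–178] -/
theorem rogCasimirScalar_conjugate (ξ : OneDimAutRepH L) (t : ℤ) (ι : L →+* ℂ) :
    rogCasimirScalar (ξ.pη (NumberField.ComplexEmbedding.conjugate ι)) (ξ.qψ (NumberField.ComplexEmbedding.conjugate ι)) (-t - 1) =
      rogCasimirScalar (ξ.pη ι) (ξ.qψ ι) t := by
  rw [OneDimAutRepH.pη_conjugate, OneDimAutRepH.qψ_conjugate, rogCasimirScalar_conj]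

/-- `e₁` at the conjugate embedding (with `t ↦ −t−1`) is `−e₁` at `ι`. [cite: Rogawski1990, §12.3 pp. 174–178] -/
theorem rogCentralSum_conjugate (ξ : OneDimAutRepH L) (t : ℤ) (ι : L →+* ℂ) :
    rogCentralSum (ξ.pη (NumberField.ComplexEmbedding.conjugate ι)) (ξ.qψ (NumberField.ComplexEmbedding.conjugate ι)) (-t - 1) =
      -rogCentralSum (ξ.pη ι) (ξ.qψ ι) t := by
  rw [OneDimAutRepH.pη_conjugate, OneDimAutRepH.qψ_conjugate, rogCentralSum_conj]

end Xi

end Summit.HodgeConjecture.HodgeConjecture.Cruxes.H413.F0P3cRogTripleChiArithmetic
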